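import Summits.QuantumFields.YangMills.Theses.MirrorModularBoosts

/-!
# `CurvatureBoostCovariance` — negative-side support I: the crux unbundled; the tie pins `S₁`; `c ≡ 0` collapse

Support file for crux `stmt-QuantumFields-9663` (`MirrorModularBoosts.CurvatureBoostCovariance`, the route's
engine), extracted from the standing disprover's work file `Cruxes/CurvatureBoostCovariance/Disproof.lean`
(§0–§2). Tree objects only; nothing is posited.

* `crux_iff`: the crux is definitionally `∀ G …, W1 r sch S₁ → EightFrameRP S₁ → PlanarCone S₁ → PlanarInvariant S₁`.
* `ModelBlind` and `curvatureBoostCovariance_of_modelBlind`: the model-blind core (every clause about `S₁` alone,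
  no gauge group / scheme / lattice tie) implies the crux. (The core is false on paper — the `W(B₄)`-symmetric
  generalised free field `(1 + ε e₂(p_μ²)²)/(p² + m²)` — so every proof of the crux must use the tie.)
* `tie_unique`: two families tied to the same Wilson scheme agree on off-diagonal real tensors of positive degree.
* `tie_apply_eq_zero_of_c_eq_zero`, `apply_linActMulti_eq_of_c_eq_zero`: with the curvature renormalisation
  `c_k = 0` a tied family vanishes on those tensors and is invariant there under EVERY isometry of `ℝ⁴`.
* `CurvatureBoostCovarianceOnAllTests`: the natural strengthening (conclusion on all of `𝓢`), refuted in
  support file III.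
-/

noncomputable section

open scoped SchwartzMap
open MeasureTheory Filter Topology
open Literature.MathematicalPhysics.AQFT Literature.MathematicalPhysics.QuantumLattice
open Literature.MathematicalPhysics.QuantumFieldTheory

namespace Summit.QuantumFields.YangMills.Theorems.CurvatureBoostCovariance.Negative

/-! ## §0 The crux unbundled -/

/-- OS clauses E0 (normalisation, hermiticity), E0', E2 (along `e₀`), E3, (EuclideanSpace ℝ (Fin 4)) of the one-species family. -/
def OSPackage (S₁ : SchwingerFamily (EuclideanSpace ℝ (Fin 4))) : Prop :=
  S₁.toLabelled.IsNormalized ∧ S₁.toLabelled.IsHermitian ∧ S₁.toLabelled.HasLinearGrowth ∧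
    S₁.toLabelled.IsReflectionPositive ∧ S₁.toLabelled.IsSymmetric ∧ S₁.toLabelled.HasClusterProperty

/-- Translation invariance on `⁰𝒮`. -/
def Translations (S₁ : SchwingerFamily (EuclideanSpace ℝ (Fin 4))) : Prop :=
  ∀ (n : ℕ) (a : (EuclideanSpace ℝ (Fin 4))) (F : 𝓢((Fin n → (EuclideanSpace ℝ (Fin 4))), ℂ)), IsOffDiagonal F → S₁ n (translateMulti a F) = S₁ n F

/-- Invariance on `⁰𝒮` under the proper signed permutations `W(B₄) ∩ SO(4)`. -/
def Hypercubic (S₁ : SchwingerFamily (EuclideanSpace ℝ (Fin 4))) : Prop :=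
  ∀ (R : (EuclideanSpace ℝ (Fin 4)) ≃ₗᵢ[ℝ] (EuclideanSpace ℝ (Fin 4))), LinearMap.det (R.toLinearEquiv : (EuclideanSpace ℝ (Fin 4)) →ₗ[ℝ] (EuclideanSpace ℝ (Fin 4))) = 1 →
    (∀ i : Fin 4, ∃ j : Fin 4, R (EuclideanSpace.single i 1) = EuclideanSpace.single j 1 ∨
      R (EuclideanSpace.single i 1) = -EuclideanSpace.single j 1) →
    ∀ (n : ℕ) (F : 𝓢((Fin n → (EuclideanSpace ℝ (Fin 4))), ℂ)), IsOffDiagonal F → S₁ n (linActMulti R F) = S₁ n F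

/-- Reflection positivity in pull-back form for the EIGHT planar frames (time axis `a e₀ + b e₁`,
`a² + b² = 1`, `a = 0 ∨ b = 0 ∨ a² = b²`). -/
def EightFrameRP (S₁ : SchwingerFamily (EuclideanSpace ℝ (Fin 4))) : Prop :=
  ∀ (R : (EuclideanSpace ℝ (Fin 4)) ≃ₗᵢ[ℝ] (EuclideanSpace ℝ (Fin 4))) (a b : ℝ), a ^ 2 + b ^ 2 = 1 → (a = 0 ∨ b = 0 ∨ a ^ 2 = b ^ 2) →
    R (EuclideanSpace.single 0 1) = a • EuclideanSpace.single 0 1 + b • EuclideanSpace.single 1 1 →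
      (SchwingerFamily.toLabelled (fun n => (S₁ n).comp (linActMulti R))).IsReflectionPositive

/-- The planar spectral cone (verbatim the conclusion of `PlanarSpectralCone` at `S₁`). -/
def PlanarCone (S₁ : SchwingerFamily (EuclideanSpace ℝ (Fin 4))) : Prop :=
  ∀ (n m : ℕ) (F : 𝓢((Fin n → (EuclideanSpace ℝ (Fin 4))), ℂ)) (G : 𝓢((Fin m → (EuclideanSpace ℝ (Fin 4))), ℂ)), IsTimeOrdered F → IsTimeOrdered G →
    ∃ Φ : ℂ × ℂ → ℂ, DifferentiableOn ℂ Φ {w : ℂ × ℂ | |w.2.im| < w.1.re} ∧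
      (∀ (t b : ℝ), 0 < t → ∀ H : 𝓢((Fin (n + m) → (EuclideanSpace ℝ (Fin 4))), ℂ),
        IsAppendTensorOf H (osAdjoint F)
          (translateMulti (t • EuclideanSpace.single 0 1 + b • EuclideanSpace.single 1 1) G) →
          Φ ((t : ℂ), (b : ℂ)) = S₁ (n + m) H) ∧
      (∀ w ∈ {w : ℂ × ℂ | |w.2.im| < w.1.re}, ∀ (HF : 𝓢((Fin (n + n) → (EuclideanSpace ℝ (Fin 4))), ℂ))
        (HG : 𝓢((Fin (m + m) → (EuclideanSpace ℝ (Fin 4))), ℂ)), IsAppendTensorOf HF (osAdjoint F) F →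
          IsAppendTensorOf HG (osAdjoint G) G → ‖Φ w‖ ^ 2 ≤ ‖S₁ (n + n) HF‖ * ‖S₁ (m + m) HG‖)

/-- The conclusion: invariance on `⁰𝒮` under every determinant-one isometry fixing `e₂, e₃`
(all rotations of the `(x₀,x₁)`-plane), all `n`. -/
def PlanarInvariant (S₁ : SchwingerFamily (EuclideanSpace ℝ (Fin 4))) : Prop :=
  ∀ (R : (EuclideanSpace ℝ (Fin 4)) ≃ₗᵢ[ℝ] (EuclideanSpace ℝ (Fin 4))), LinearMap.det (R.toLinearEquiv : (EuclideanSpace ℝ (Fin 4)) →ₗ[ℝ] (EuclideanSpace ℝ (Fin 4))) = 1 →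
    R (EuclideanSpace.single 2 1) = EuclideanSpace.single 2 1 →
    R (EuclideanSpace.single 3 1) = EuclideanSpace.single 3 1 →
      ∀ (n : ℕ) (F : 𝓢((Fin n → (EuclideanSpace ℝ (Fin 4))), ℂ)), IsOffDiagonal F → S₁ n (linActMulti R F) = S₁ n F

/-- The same conclusion WITHOUT the restriction to `⁰𝒮` (equality of functionals on all of `𝓢`):
the natural strengthening refuted in support file III. -/
def PlanarInvariantOnAllTests (S₁ : SchwingerFamily (EuclideanSpace ℝ (Fin 4))) : Prop :=
  ∀ (R : (EuclideanSpace ℝ (Fin 4)) ≃ₗᵢ[ℝ] (EuclideanSpace ℝ (Fin 4))), LinearMap.det (R.toLinearEquiv : (EuclideanSpace ℝ (Fin 4)) →ₗ[ℝ] (EuclideanSpace ℝ (Fin 4))) = 1 →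
    R (EuclideanSpace.single 2 1) = EuclideanSpace.single 2 1 →
    R (EuclideanSpace.single 3 1) = EuclideanSpace.single 3 1 →
      ∀ (n : ℕ) (F : 𝓢((Fin n → (EuclideanSpace ℝ (Fin 4))), ℂ)), S₁ n (linActMulti R F) = S₁ n F

section Lattice

variable {G : Type} [Group G] [TopologicalSpace G] [IsTopologicalGroup G] [CompactSpace G]
  [MeasurableSpace G] [BorelSpace G]

/-- The lattice TIE (first clause of `W₁`): convergence of the renormalised action-density strings
to `S₁` on off-diagonal real tensors, `n ≠ 0`. -/
def Tie (r : LatticeRep G) (sch : SpeciesScheme (YMSpecies G)) (S₁ : SchwingerFamily (EuclideanSpace ℝ (Fin 4))) : Prop :=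
  ∀ (n : ℕ), n ≠ 0 → ∀ (f : Fin n → 𝓢((EuclideanSpace ℝ (Fin 4)), ℝ)) (F : 𝓢((Fin n → (EuclideanSpace ℝ (Fin 4))), ℂ)),
    IsTensorOf F (fun i => ofRealTest (f i)) → IsOffDiagonal F →
      Tendsto (fun k : ℕ => ((latticeSchwinger r.ρ sch (fun s => s.F) k n
        (fun _ => r.curvature) f : ℝ) : ℂ)) atTop (𝓝 (S₁ n F))

/-- The two gaps: continuum `HasMassGap` of `S₁` and the uniform lattice gap of the scheme. -/
def Gaps {κ : Type} (r : LatticeRep G) (sch : SpeciesScheme κ) (S₁ : SchwingerFamily (EuclideanSpace ℝ (Fin 4))) : Prop :=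
  ∃ Δ : ℝ, 0 < Δ ∧ S₁.toLabelled.HasMassGap Δ ∧ HasLatticeMassGap r sch Δ

/-- The curvature-channel package `W₁ r sch S₁` of the crux, unbundled. -/
def W1 (r : LatticeRep G) (sch : SpeciesScheme (YMSpecies G)) (S₁ : SchwingerFamily (EuclideanSpace ℝ (Fin 4))) : Prop :=
  Tie r sch S₁ ∧ OSPackage S₁ ∧ Translations S₁ ∧ Hypercubic S₁ ∧ Gaps r sch S₁

end Lattice

/-- **§0. The crux, unbundled** (definitional): for every compact simple `G` (Borel σ-algebra),
`W1 r sch S₁ → EightFrameRP S₁ → PlanarCone S₁ → PlanarInvariant S₁`. -/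
theorem crux_iff :
    Summit.QuantumFields.YangMills.Theses.MirrorModularBoosts.CurvatureBoostCovariance ↔
      ∀ (G : Type) [Group G] [TopologicalSpace G] [IsTopologicalGroup G] [CompactSpace G],
        IsCompactSimpleLieGroup G →
        letI : MeasurableSpace G := borel G
        haveI : BorelSpace G := ⟨rfl⟩
        ∀ (r : LatticeRep G) (sch : SpeciesScheme (YMSpecies G)) (S₁ : SchwingerFamily (EuclideanSpace ℝ (Fin 4))),
          W1 r sch S₁ → EightFrameRP S₁ → PlanarCone S₁ → PlanarInvariant S₁ :=
  Iff.rfl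

/-- The natural strengthening of the crux: same hypotheses, conclusion on ALL test functions. -/
def CurvatureBoostCovarianceOnAllTests : Prop :=
  ∀ (G : Type) [Group G] [TopologicalSpace G] [IsTopologicalGroup G] [CompactSpace G],
    IsCompactSimpleLieGroup G →
    letI : MeasurableSpace G := borel G
    haveI : BorelSpace G := ⟨rfl⟩
    ∀ (r : LatticeRep G) (sch : SpeciesScheme (YMSpecies G)) (S₁ : SchwingerFamily (EuclideanSpace ℝ (Fin 4))),
      W1 r sch S₁ → EightFrameRP S₁ → PlanarCone S₁ → PlanarInvariantOnAllTests S₁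

/-! ## §1 The model-blind core -/

/-- **The model-blind core** of the crux: drop the gauge group, the lattice representation, the
scheme, the lattice tie and the lattice gap; keep every clause that speaks about `S₁` alone. -/
def ModelBlind : Prop :=
  ∀ (S₁ : SchwingerFamily (EuclideanSpace ℝ (Fin 4))), OSPackage S₁ → Translations S₁ → Hypercubic S₁ →
    (∃ Δ : ℝ, 0 < Δ ∧ S₁.toLabelled.HasMassGap Δ) → EightFrameRP S₁ → PlanarCone S₁ →
      PlanarInvariant S₁

/-- **§1a. The model-blind core implies the crux** (the crux is the core restricted to Wilson
limits of the curvature channel).  Hence a PROOF of the crux that never uses the lattice tie is a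
proof of `ModelBlind` — which is false on paper (see the work file §1b): the tie is load-bearing for every proof. -/
theorem curvatureBoostCovariance_of_modelBlind (h : ModelBlind) :
    Summit.QuantumFields.YangMills.Theses.MirrorModularBoosts.CurvatureBoostCovariance := by
  rw [crux_iff]
  intro G _ _ _ _ _ r sch S₁ hW h8 hC
  exact h S₁ hW.2.1 hW.2.2.1 hW.2.2.2.1 (hW.2.2.2.2.imp fun Δ hΔ => ⟨hΔ.1, hΔ.2.1⟩) h8 hC

/-! ## §2 The tie pins `S₁` on `⁰𝒮`; collapse of the `c ≡ 0` schemes -/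

section TieLemmas

variable {G : Type} [Group G] [TopologicalSpace G] [IsTopologicalGroup G] [CompactSpace G]
  [MeasurableSpace G] [BorelSpace G]

/-- **§2a. Uniqueness of the tied values.** Two families tied to the same `(r, sch)` agree on
every off-diagonal real tensor of positive degree: the tie PINS `S₁` there (limits in `ℂ` are
unique).  Since off-diagonal real tensors span a dense subspace of `⁰𝒮ₙ` and the conclusion reads
`S₁` only on `⁰𝒮`, a counterexample to the crux IS a Wilson scaling limit of the `tr F²` strings
that is not planar-rotation invariant — nothing less. -/
theorem tie_unique {r : LatticeRep G} {sch : SpeciesScheme (YMSpecies G)}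
    {S₁ S₁' : SchwingerFamily (EuclideanSpace ℝ (Fin 4))} (h : Tie r sch S₁) (h' : Tie r sch S₁') {n : ℕ} (hn : n ≠ 0)
    (f : Fin n → 𝓢((EuclideanSpace ℝ (Fin 4)), ℝ)) (F : 𝓢((Fin n → (EuclideanSpace ℝ (Fin 4))), ℂ)) (hF : IsTensorOf F fun i => ofRealTest (f i))
    (hF' : IsOffDiagonal F) : S₁ n F = S₁' n F :=
  tendsto_nhds_unique (h n hn f F hF hF') (h' n hn f F hF hF')

/-- With the curvature's multiplicative renormalisation switched off (`c_k = 0`) every lattice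
`n`-point function of the curvature string vanishes identically, `n ≠ 0`. -/
theorem latticeSchwinger_eq_zero_of_c_eq_zero (r : LatticeRep G) (sch : SpeciesScheme (YMSpecies G))
    (hc : ∀ k, sch.c r.curvature k = 0) (k : ℕ) {n : ℕ} (hn : n ≠ 0) (f : Fin n → 𝓢((EuclideanSpace ℝ (Fin 4)), ℝ)) :
    latticeSchwinger r.ρ sch (fun s => s.F) k n (fun _ => r.curvature) f = 0 := by
  obtain ⟨j, rfl⟩ := Nat.exists_eq_succ_of_ne_zero hn
  simp [latticeSchwinger, smearedLatticeField, hc k]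

/-- **§2b. Collapse of the `c ≡ 0` schemes** (in particular `SpeciesScheme.zero`): a tied family
VANISHES on every off-diagonal real tensor of positive degree, whatever `β_k, m_k, a_k, L_k`. -/
theorem tie_apply_eq_zero_of_c_eq_zero {r : LatticeRep G} {sch : SpeciesScheme (YMSpecies G)}
    {S₁ : SchwingerFamily (EuclideanSpace ℝ (Fin 4))} (h : Tie r sch S₁) (hc : ∀ k, sch.c r.curvature k = 0) {n : ℕ}
    (hn : n ≠ 0) (f : Fin n → 𝓢((EuclideanSpace ℝ (Fin 4)), ℝ)) (F : 𝓢((Fin n → (EuclideanSpace ℝ (Fin 4))), ℂ))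
    (hF : IsTensorOf F fun i => ofRealTest (f i)) (hF' : IsOffDiagonal F) : S₁ n F = 0 := by
  have ht := h n hn f F hF hF'
  simp only [latticeSchwinger_eq_zero_of_c_eq_zero r sch hc _ hn, Complex.ofReal_zero] at ht
  exact tendsto_nhds_unique ht tendsto_const_nhds

end TieLemmas

/-- `⁰𝒮` is stable under the diagonal action of a linear isometry. -/
theorem isOffDiagonal_linActMulti {n : ℕ} {F : 𝓢((Fin n → (EuclideanSpace ℝ (Fin 4))), ℂ)} (hF : IsOffDiagonal F)
    (R : (EuclideanSpace ℝ (Fin 4)) ≃ₗᵢ[ℝ] (EuclideanSpace ℝ (Fin 4))) : IsOffDiagonal (linActMulti R F) := by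
  intro x hx k
  set g : (Fin n → (EuclideanSpace ℝ (Fin 4))) ≃L[ℝ] (Fin n → (EuclideanSpace ℝ (Fin 4))) :=
    ContinuousLinearEquiv.piCongrRight fun _ : Fin n => R.symm.toContinuousLinearEquiv with hg
  have hfun : ((linActMulti R F : 𝓢((Fin n → (EuclideanSpace ℝ (Fin 4))), ℂ)) : (Fin n → (EuclideanSpace ℝ (Fin 4))) → ℂ) = (F : _ → ℂ) ∘ g := by
    funext y; rfl
  have hgx : g x ∈ coincidenceLocus n (EuclideanSpace ℝ (Fin 4)) := by
    obtain ⟨i, j, hij, hxij⟩ := hx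
    exact ⟨i, j, hij, by simp [hg, hxij]⟩
  have h0 : iteratedFDeriv ℝ k (F : (Fin n → (EuclideanSpace ℝ (Fin 4))) → ℂ) (g x) = 0 := hF _ hgx k
  have key := (g : (Fin n → (EuclideanSpace ℝ (Fin 4))) →L[ℝ] (Fin n → (EuclideanSpace ℝ (Fin 4)))).iteratedFDeriv_comp_right
    (F.smooth k) x (i := k) le_rfl
  simp only [ContinuousLinearEquiv.coe_coe] at key
  rw [hfun, key, h0]
  ext m
  simp

section TieLemmas2

variable {G : Type} [Group G] [TopologicalSpace G] [IsTopologicalGroup G] [CompactSpace G]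
  [MeasurableSpace G] [BorelSpace G]

/-- **§2c. No counterexample from any `c ≡ 0` scheme**: a tied family is invariant on off-diagonal
real tensors under EVERY linear isometry of `ℝ⁴` (both sides vanish) — for the zero scheme the
conclusion of the crux holds on tensors without E2, the cone, or any other clause. -/
theorem apply_linActMulti_eq_of_c_eq_zero {r : LatticeRep G} {sch : SpeciesScheme (YMSpecies G)}
    {S₁ : SchwingerFamily (EuclideanSpace ℝ (Fin 4))} (h : Tie r sch S₁) (hc : ∀ k, sch.c r.curvature k = 0)
    (R : (EuclideanSpace ℝ (Fin 4)) ≃ₗᵢ[ℝ] (EuclideanSpace ℝ (Fin 4))) {n : ℕ} (hn : n ≠ 0) (f : Fin n → 𝓢((EuclideanSpace ℝ (Fin 4)), ℝ)) (F : 𝓢((Fin n → (EuclideanSpace ℝ (Fin 4))), ℂ))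
    (hF : IsTensorOf F fun i => ofRealTest (f i)) (hF' : IsOffDiagonal F) :
    S₁ n (linActMulti R F) = S₁ n F := by
  rw [tie_apply_eq_zero_of_c_eq_zero h hc hn f F hF hF',
    tie_apply_eq_zero_of_c_eq_zero h hc hn _ _ (hF.linActMulti R) (isOffDiagonal_linActMulti hF' R)]

end TieLemmas2



end Summit.QuantumFields.YangMills.Theorems.CurvatureBoostCovariance.Negative

end
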